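import Literature.Analysis.FluidPDE.BiotSavart2DRegularity
import Literature.Analysis.FunctionSpaces.BMOLogProofs
import HarnessLib

/-!
# The planar logarithmic potential of a `C¹_c` vorticity: `∇(N ∗ w) = −(K_{2D} ∗ w)^⊥`, `Δ(N ∗ w) = w`

Analysis/FluidPDE file (all results proved, no definitions, no named facts). For a vorticity
`w ∈ C¹_c(ℝ²)` the logarithmic (Newtonian) potential

  `ψ(x) = (N ∗ w)(x) = ∫ w(y) (2π)⁻¹ log|x − y| dy`,  `N(z) = (2π)⁻¹ log|z|`,

written throughout as the explicit function `fun x => ∫ y, w y * ((2π)⁻¹ * Real.log ‖x - y‖)`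
(Mathlib's convolution `w ⋆[mul] N`, `integral_mul_logKernel_eq_convolution`), is the stream
function of the Biot–Savart velocity `v = K_{2D} ∗ w` (`biotSavart2D`):

* `locallyIntegrable_logKernel` — `N ∈ L¹_loc(ℝ²)` (the tree's
  `BMOLog.locallyIntegrable_log_norm`);
* `contDiff_logPotential`, `fderiv_logPotential_apply` — `ψ ∈ C^n` for `w ∈ C^n_c`, with the
  derivatives on `w`;
* `fderiv_logPotential_eq` — **`Dψ(x)[h] = −⟪v(x)^⊥, h⟫`, i.e. `∇ψ = −v^⊥`** (so `v = ∇^⊥ψ`):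
  through the smooth regularisation `N_ε(z) = (4π)⁻¹ log(|z|² + ε²)`, whose gradient is
  `z/(2π(|z|² + ε²)) = −K_ε(z)^⊥` (`K_ε` the regularised Biot–Savart kernel of
  `PlanarBiotSavartDivFree`), dominated convergence `N_ε → N` (`|N_ε| ≤ C(|log|z|| + |z|² + 1)`
  a.e.) and `K_ε → K_{2D}` (`BiotSavart2DRegularity`);
* `laplacian_logPotential` — **`Δψ = w` pointwise** for `w ∈ C²_c` (`Δψ = curl v = w`,
  `curl_biotSavart2D_eq`).

This is the classical statement that `N` is the fundamental solution of the Laplacian in the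
plane, for `C²_c` data (Gilbarg–Trudinger, Lemma 4.2 with (4.6)), proved here without boundary
integrals.

## References

* D. Gilbarg, N. S. Trudinger, *Elliptic Partial Differential Equations of Second Order*,
  Springer (2001), §2.4 (2.12), §4.1 Lemma 4.1–4.2. [GilbargTrudinger2001]
* A. J. Majda, A. L. Bertozzi, *Vorticity and Incompressible Flow*, CUP (2002), §2.1
  (`v = ∇^⊥ψ`, `Δψ = ω`). [folklore]
-/

open MeasureTheory Filter Set Metric Function
open scoped Real RealInnerProductSpace Topology InnerProductSpace Convolution Laplacian

noncomputable section

namespace Literature.Analysis.FluidPDE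

/-! ### The logarithmic kernel is locally integrable -/

/-- `|log r| ≤ r⁻¹ + r` for `r > 0`. [folklore] -/
theorem abs_log_le_inv_add_self {r : ℝ} (hr : 0 < r) : |Real.log r| ≤ r⁻¹ + r := by
  rw [abs_le]
  constructor
  · have := Real.one_sub_inv_le_log_of_pos hr
    have h0 : 0 ≤ r := hr.le
    linarith
  · have := Real.log_le_self hr.le
    have h0 : 0 ≤ r⁻¹ := by positivity
    linarith

/-- The normalised kernel `N(z) = (2π)⁻¹ log|z|` is locally integrable (`log|z| ∈ L¹_loc`, the
tree's `BMOLog.locallyIntegrable_log_norm`). [folklore] -/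
theorem locallyIntegrable_logKernel :
    LocallyIntegrable fun z : EuclideanSpace ℝ (Fin 2) => (2 * π)⁻¹ * Real.log ‖z‖ :=
  (Literature.Analysis.FunctionSpaces.BMOLog.locallyIntegrable_log_norm
    (E := EuclideanSpace ℝ (Fin 2))).smul ((2 * π)⁻¹ : ℝ)

/-! ### The logarithmic potential as a convolution; smoothness -/

/-- `ψ = w ⋆[mul] N`: the logarithmic potential is Mathlib's convolution of the density with the
kernel `N(z) = (2π)⁻¹ log|z|`. [folklore] -/
theorem integral_mul_logKernel_eq_convolution (w : EuclideanSpace ℝ (Fin 2) → ℝ) :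
    (fun x => ∫ y, w y * ((2 * π)⁻¹ * Real.log ‖x - y‖)) =
      (w ⋆[ContinuousLinearMap.mul ℝ ℝ, volume]
        fun z : EuclideanSpace ℝ (Fin 2) => (2 * π)⁻¹ * Real.log ‖z‖) := by
  funext x
  rw [convolution_def]
  rfl

/-- **`ψ = N ∗ w ∈ C^n` for `w ∈ C^n_c(ℝ²)`.** [folklore] -/
theorem contDiff_logPotential {w : EuclideanSpace ℝ (Fin 2) → ℝ} {n : ℕ∞} (hw : ContDiff ℝ n w)
    (hwc : HasCompactSupport w) :
    ContDiff ℝ n fun x => ∫ y, w y * ((2 * π)⁻¹ * Real.log ‖x - y‖) := by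
  rw [integral_mul_logKernel_eq_convolution]
  exact hwc.contDiff_convolution_left _ hw locallyIntegrable_logKernel

/-- **`Dψ(x)[h] = ∫ Dw(y)[h] N(x − y) dy`**: the derivative of the logarithmic potential of
`w ∈ C¹_c` falls on the density. [folklore] -/
theorem fderiv_logPotential_apply {w : EuclideanSpace ℝ (Fin 2) → ℝ} (hw : ContDiff ℝ 1 w)
    (hwc : HasCompactSupport w) (x h : EuclideanSpace ℝ (Fin 2)) :
    fderiv ℝ (fun x => ∫ y, w y * ((2 * π)⁻¹ * Real.log ‖x - y‖)) x h =
      ∫ y, fderiv ℝ w y h * ((2 * π)⁻¹ * Real.log ‖x - y‖) := by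
  rw [integral_mul_logKernel_eq_convolution,
    (hwc.hasFDerivAt_convolution_left _ hw locallyIntegrable_logKernel x).fderiv, convolution_def]
  have hint : Integrable (fun t => ((ContinuousLinearMap.mul ℝ ℝ).precompL
      (EuclideanSpace ℝ (Fin 2))) (fderiv ℝ w t) ((2 * π)⁻¹ * Real.log ‖x - t‖)) volume :=
    ((hwc.fderiv ℝ).convolutionExists_left _ (hw.continuous_fderiv one_ne_zero)
      locallyIntegrable_logKernel x).integrable
  rw [ContinuousLinearMap.integral_apply hint h]
  rfl

/-! ### The regularised kernel `N_ε(z) = (4π)⁻¹ log(|z|² + ε²)` -/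

section RegLog

variable {ε : ℝ} (hε : 0 < ε)
include hε

/-- `N_ε` is `C¹`. [folklore] -/
theorem contDiff_logRegKernel :
    ContDiff ℝ 1 fun z : EuclideanSpace ℝ (Fin 2) => (4 * π)⁻¹ * Real.log (‖z‖ ^ 2 + ε ^ 2) :=
  contDiff_const.mul (((contDiff_norm_sq ℝ).add contDiff_const).log fun z =>
    (normSq_add_sq_pos hε z).ne')

/-- **`∇N_ε(z) = z/(2π(|z|² + ε²))`**: `DN_ε(z)[h] = (2π(|z|² + ε²))⁻¹ ⟪z, h⟫`. [folklore] -/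
theorem fderiv_logRegKernel (z h : EuclideanSpace ℝ (Fin 2)) :
    fderiv ℝ (fun z : EuclideanSpace ℝ (Fin 2) => (4 * π)⁻¹ * Real.log (‖z‖ ^ 2 + ε ^ 2)) z h =
      (2 * π * (‖z‖ ^ 2 + ε ^ 2))⁻¹ * ⟪z, h⟫ := by
  have hs := hasFDerivAt_normSq_add_sq (ε := ε) z
  have hpos := normSq_add_sq_pos hε z
  have h := (hs.log hpos.ne').const_mul (4 * π)⁻¹
  rw [h.fderiv]
  simp only [_root_.smul_apply, innerSL_apply_apply, smul_eq_mul]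
  have hπ : (π : ℝ) ≠ 0 := Real.pi_pos.ne'
  field_simp
  ring

/-- `∇N_ε = −K_ε^⊥` in components: `DN_ε(z)[h] = (K_ε)₁(z) h₀ − (K_ε)₀(z) h₁`. [folklore] -/
theorem fderiv_logRegKernel_eq_regKernel (z h : EuclideanSpace ℝ (Fin 2)) :
    fderiv ℝ (fun z : EuclideanSpace ℝ (Fin 2) => (4 * π)⁻¹ * Real.log (‖z‖ ^ 2 + ε ^ 2)) z h =
      ((2 * π * (‖z‖ ^ 2 + ε ^ 2))⁻¹ • perp z) 1 * h 0 -
        ((2 * π * (‖z‖ ^ 2 + ε ^ 2))⁻¹ • perp z) 0 * h 1 := by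
  rw [fderiv_logRegKernel hε, regKernel_apply_zero, regKernel_apply_one, PiLp.inner_apply,
    Fin.sum_univ_two]
  simp only [RCLike.inner_apply, conj_trivial]
  ring

/-- **Domination of `N_ε` uniformly in `0 < ε ≤ 1`**, off the origin:
`|log(|z|² + ε²)| ≤ 2(|z|⁻¹ + |z|) + |z|²` for `z ≠ 0` (`log|z|² ≤ log(|z|² + ε²) ≤ log(|z|² + 1)`,
`|log r| ≤ r⁻¹ + r`, `log t ≤ t − 1`). [folklore] -/
theorem abs_log_normSq_add_sq_le (hε1 : ε ≤ 1) {z : EuclideanSpace ℝ (Fin 2)} (hz : z ≠ 0) :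
    |Real.log (‖z‖ ^ 2 + ε ^ 2)| ≤ 2 * (‖z‖⁻¹ + ‖z‖) + ‖z‖ ^ 2 := by
  have hn : 0 < ‖z‖ := norm_pos_iff.2 hz
  have hn2 : 0 < ‖z‖ ^ 2 := by positivity
  have hlow : Real.log (‖z‖ ^ 2) ≤ Real.log (‖z‖ ^ 2 + ε ^ 2) :=
    Real.log_le_log hn2 (by nlinarith [sq_nonneg ε])
  have hup : Real.log (‖z‖ ^ 2 + ε ^ 2) ≤ Real.log (‖z‖ ^ 2 + 1) :=
    Real.log_le_log (normSq_add_sq_pos hε z) (by nlinarith)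
  have hup' : Real.log (‖z‖ ^ 2 + 1) ≤ ‖z‖ ^ 2 := by
    have := Real.log_le_sub_one_of_pos (show (0 : ℝ) < ‖z‖ ^ 2 + 1 by positivity)
    linarith
  have hsq : Real.log (‖z‖ ^ 2) = 2 * Real.log ‖z‖ := by
    rw [Real.log_pow]; norm_num
  have habs := abs_log_le_inv_add_self hn
  rw [abs_le] at habs ⊢
  have h0 : 0 ≤ ‖z‖⁻¹ + ‖z‖ := by positivity
  constructor <;> nlinarith [habs.1, habs.2]

end RegLog

/-- The local majorant `z ↦ 2(|z|⁻¹ + |z|) + |z|²` is locally integrable on `ℝ²`. [folklore] -/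
theorem locallyIntegrable_logMajorant :
    LocallyIntegrable fun z : EuclideanSpace ℝ (Fin 2) => 2 * (‖z‖⁻¹ + ‖z‖) + ‖z‖ ^ 2 := by
  have hinv : LocallyIntegrable fun z : EuclideanSpace ℝ (Fin 2) => ‖z‖⁻¹ := by
    refine (locallyIntegrable_iff).2 fun k hk => ?_
    obtain ⟨R, hR⟩ := hk.isBounded.subset_ball 0
    exact (integrableOn_inv_norm_ball R).mono_set hR
  exact ((hinv.add continuous_norm.locallyIntegrable).smul (2 : ℝ)).add
    ((continuous_norm.pow 2).locallyIntegrable)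

/-! ### `∇ψ = −v^⊥` -/

section Gradient

variable {w : EuclideanSpace ℝ (Fin 2) → ℝ} (hw : ContDiff ℝ 1 w) (hwc : HasCompactSupport w)
include hw hwc

/-- **Dominated convergence `N_ε → N` inside `∫ Dw[h] N_ε(x − ·)`** (`ε = 1/(k+1) → 0`):
`∫ Dw(y)[h] (4π)⁻¹log(|x−y|² + ε²) dy → ∫ Dw(y)[h] (2π)⁻¹log|x−y| dy`. [folklore] -/
theorem tendsto_integral_fderiv_mul_logRegKernel (x h : EuclideanSpace ℝ (Fin 2)) :
    Tendsto (fun k : ℕ => ∫ y, fderiv ℝ w y h *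
        ((4 * π)⁻¹ * Real.log (‖x - y‖ ^ 2 + (((k : ℝ) + 1)⁻¹) ^ 2)))
      atTop (𝓝 (∫ y, fderiv ℝ w y h * ((2 * π)⁻¹ * Real.log ‖x - y‖))) := by
  have hεk : ∀ k : ℕ, (0 : ℝ) < ((k : ℝ) + 1)⁻¹ := fun k => by positivity
  have hεk1 : ∀ k : ℕ, ((k : ℝ) + 1)⁻¹ ≤ 1 := fun k =>
    inv_le_one_of_one_le₀ (by simp)
  have hg : Continuous fun y => fderiv ℝ w y h :=
    (hw.continuous_fderiv one_ne_zero).clm_apply continuous_const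
  have hgc : HasCompactSupport fun y => fderiv ℝ w y h := hwc.fderiv_apply (𝕜 := ℝ) h
  -- the dominating function `‖Dw(y)[h]‖ · (4π)⁻¹(2(|x−y|⁻¹ + |x−y|) + |x−y|²)`
  have hdom : Integrable fun y => ‖fderiv ℝ w y h‖ *
      ((4 * π)⁻¹ * (2 * (‖x - y‖⁻¹ + ‖x - y‖) + ‖x - y‖ ^ 2)) :=
    ((hgc.norm.convolutionExists_left (ContinuousLinearMap.mul ℝ ℝ) hg.norm
      (locallyIntegrable_logMajorant.smul ((4 * π)⁻¹ : ℝ)) x)).integrable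
  refine tendsto_integral_of_dominated_convergence _ (fun k => ?_) hdom
    (fun k => ?_) ?_
  · have hc : Continuous fun y : EuclideanSpace ℝ (Fin 2) =>
        (4 * π)⁻¹ * Real.log (‖x - y‖ ^ 2 + (((k : ℝ) + 1)⁻¹) ^ 2) :=
      ((contDiff_logRegKernel (hεk k)).continuous).comp (continuous_const.sub continuous_id)
    exact (hg.mul hc).aestronglyMeasurable
  · -- domination holds off the null set `{x}`
    have hae : ∀ᵐ y : EuclideanSpace ℝ (Fin 2) ∂volume, y ≠ x := by
      rw [ae_iff]; simp
    filter_upwards [hae] with y hy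
    have hz : x - y ≠ 0 := sub_ne_zero.2 (Ne.symm hy)
    rw [norm_mul]
    refine mul_le_mul_of_nonneg_left ?_ (norm_nonneg _)
    rw [norm_mul, Real.norm_of_nonneg (by positivity : (0 : ℝ) ≤ (4 * π)⁻¹), Real.norm_eq_abs]
    exact mul_le_mul_of_nonneg_left (abs_log_normSq_add_sq_le (hεk k) (hεk1 k) hz)
      (by positivity)
  · have hae : ∀ᵐ y : EuclideanSpace ℝ (Fin 2) ∂volume, y ≠ x := by
      rw [ae_iff]; simp
    filter_upwards [hae] with y hy
    have hz : x - y ≠ 0 := sub_ne_zero.2 (Ne.symm hy)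
    have hn2 : 0 < ‖x - y‖ ^ 2 := by positivity
    refine Tendsto.mul tendsto_const_nhds ?_
    have h1 : Tendsto (fun k : ℕ => ((k : ℝ) + 1)⁻¹) atTop (𝓝 0) := by
      simpa [one_div] using tendsto_one_div_add_atTop_nhds_zero_nat (𝕜 := ℝ)
    have h2 : Tendsto (fun k : ℕ => ‖x - y‖ ^ 2 + (((k : ℝ) + 1)⁻¹) ^ 2) atTop
        (𝓝 (‖x - y‖ ^ 2)) := by
      have := (h1.pow 2).const_add (‖x - y‖ ^ 2)
      rwa [zero_pow two_ne_zero, add_zero] at this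
    have h3 := ((Real.continuousAt_log hn2.ne').tendsto.comp h2).const_mul (4 * π)⁻¹
    have hsq : (4 * π)⁻¹ * Real.log (‖x - y‖ ^ 2) = (2 * π)⁻¹ * Real.log ‖x - y‖ := by
      rw [Real.log_pow]
      have hπ : (π : ℝ) ≠ 0 := Real.pi_pos.ne'
      field_simp
      ring
    rw [Function.comp_def, hsq] at h3
    exact h3

/-- For every `ε > 0`: `∫ Dw(y)[h] N_ε(x − y) dy = h₀ ∫ w (K_ε(x−·))₁ − h₁ ∫ w (K_ε(x−·))₀` (the
derivative moved onto `N_ε`, `∇N_ε = −K_ε^⊥`). [folklore] -/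
theorem integral_fderiv_mul_logRegKernel_eq {ε : ℝ} (hε : 0 < ε) (x h : EuclideanSpace ℝ (Fin 2)) :
    ∫ y, fderiv ℝ w y h * ((4 * π)⁻¹ * Real.log (‖x - y‖ ^ 2 + ε ^ 2)) =
      h 0 * (∫ y, w y * ((2 * π * (‖x - y‖ ^ 2 + ε ^ 2))⁻¹ • perp (x - y)) 1) -
        h 1 * (∫ y, w y * ((2 * π * (‖x - y‖ ^ 2 + ε ^ 2))⁻¹ • perp (x - y)) 0) := by
  rw [integral_fderiv_mul_comp_sub_eq hw hwc (contDiff_logRegKernel hε) x h]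
  simp_rw [fderiv_logRegKernel_eq_regKernel hε]
  have hcK : Continuous fun y : EuclideanSpace ℝ (Fin 2) =>
      (2 * π * (‖x - y‖ ^ 2 + ε ^ 2))⁻¹ • perp (x - y) :=
    (((contDiff_regFactor hε).continuous).smul continuous_perp).comp
      (continuous_const.sub continuous_id)
  have hcj : ∀ j : Fin 2, Continuous fun y : EuclideanSpace ℝ (Fin 2) =>
      ((2 * π * (‖x - y‖ ^ 2 + ε ^ 2))⁻¹ • perp (x - y)) j := fun j =>
    (EuclideanSpace.proj (𝕜 := ℝ) j).continuous.comp hcK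
  have i1 : Integrable fun y => w y *
      (((2 * π * (‖x - y‖ ^ 2 + ε ^ 2))⁻¹ • perp (x - y)) 1 * h 0) :=
    (hw.continuous.mul ((hcj 1).mul continuous_const)).integrable_of_hasCompactSupport
      hwc.mul_right
  have i0 : Integrable fun y => w y *
      (((2 * π * (‖x - y‖ ^ 2 + ε ^ 2))⁻¹ • perp (x - y)) 0 * h 1) :=
    (hw.continuous.mul ((hcj 0).mul continuous_const)).integrable_of_hasCompactSupport
      hwc.mul_right
  simp_rw [mul_sub]
  rw [integral_sub i1 i0, ← integral_const_mul, ← integral_const_mul]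
  congr 1
  · exact integral_congr_ae (Eventually.of_forall fun y => by dsimp only; ring)
  · exact integral_congr_ae (Eventually.of_forall fun y => by dsimp only; ring)

/-- **`Dψ(x)[h] = −⟪v(x)^⊥, h⟫` for `ψ = N ∗ w`, `v = K_{2D} ∗ w`, `w ∈ C¹_c(ℝ²)`** — the
logarithmic potential is a stream function of the Biot–Savart velocity: `∇ψ = −v^⊥`,
`v = ∇^⊥ψ`. [folklore] -/
theorem fderiv_logPotential_eq (x h : EuclideanSpace ℝ (Fin 2)) :
    fderiv ℝ (fun x => ∫ y, w y * ((2 * π)⁻¹ * Real.log ‖x - y‖)) x h =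
      -⟪perp (biotSavart2D w x), h⟫ := by
  have hεk : ∀ k : ℕ, (0 : ℝ) < ((k : ℝ) + 1)⁻¹ := fun k => by positivity
  rw [fderiv_logPotential_apply hw hwc]
  have hA := tendsto_integral_fderiv_mul_logRegKernel hw hwc x h
  have hB1 := tendsto_integral_mul_regKernel_apply hw.continuous hwc x 1
  have hB0 := tendsto_integral_mul_regKernel_apply hw.continuous hwc x 0
  have hB := (hB1.const_mul (h 0)).sub (hB0.const_mul (h 1))
  have heq : ∀ k : ℕ, (∫ y, fderiv ℝ w y h *
      ((4 * π)⁻¹ * Real.log (‖x - y‖ ^ 2 + (((k : ℝ) + 1)⁻¹) ^ 2))) =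
      h 0 * (∫ y, w y * ((2 * π * (‖x - y‖ ^ 2 + (((k : ℝ) + 1)⁻¹) ^ 2))⁻¹ • perp (x - y)) 1) -
        h 1 * (∫ y, w y *
          ((2 * π * (‖x - y‖ ^ 2 + (((k : ℝ) + 1)⁻¹) ^ 2))⁻¹ • perp (x - y)) 0) :=
    fun k => integral_fderiv_mul_logRegKernel_eq hw hwc (hεk k) x h
  simp_rw [heq] at hA
  have hlim := tendsto_nhds_unique hA hB
  rw [hlim]
  -- identify the components of `v(x)`
  obtain ⟨M, hM⟩ := hw.continuous.bounded_above_of_compact_support hwc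
  have hint : Integrable fun y => w y • biotSavartKernel2D (x - y) :=
    integrable_smul_biotSavartKernel2D (hw.continuous.integrable_of_hasCompactSupport hwc)
      (fun y => (Real.norm_eq_abs _).symm.le.trans (hM y)) x
  rw [← biotSavart2D_apply_eq_integral hint 1, ← biotSavart2D_apply_eq_integral hint 0,
    PiLp.inner_apply, Fin.sum_univ_two]
  simp only [RCLike.inner_apply, conj_trivial, perp_apply_zero, perp_apply_one]
  ring

/-- **`∇ψ = −v^⊥`** (gradient form of `fderiv_logPotential_eq`). [folklore] -/
theorem gradient_logPotential_eq (x : EuclideanSpace ℝ (Fin 2)) :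
    gradient (fun x => ∫ y, w y * ((2 * π)⁻¹ * Real.log ‖x - y‖)) x =
      -perp (biotSavart2D w x) := by
  refine ext_inner_right ℝ fun h => ?_
  rw [gradient, InnerProductSpace.toDual_symm_apply, fderiv_logPotential_eq hw hwc,
    inner_neg_left]

/-- The partial derivatives of `ψ`: `∂₀ψ = v₁`, `∂₁ψ = −v₀`. [folklore] -/
theorem fderiv_logPotential_single (x : EuclideanSpace ℝ (Fin 2)) :
    fderiv ℝ (fun x => ∫ y, w y * ((2 * π)⁻¹ * Real.log ‖x - y‖)) x
        (EuclideanSpace.single 0 1) = biotSavart2D w x 1 ∧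
      fderiv ℝ (fun x => ∫ y, w y * ((2 * π)⁻¹ * Real.log ‖x - y‖)) x
        (EuclideanSpace.single 1 1) = -biotSavart2D w x 0 := by
  constructor <;>
  · rw [fderiv_logPotential_eq hw hwc, PiLp.inner_apply, Fin.sum_univ_two]
    simp [perp_apply_zero, perp_apply_one]

end Gradient

/-! ### `Δψ = w` -/

/-- The Laplacian on `ℝ²` in coordinates for a `C²` function: `Δφ = ∂₀∂₀φ + ∂₁∂₁φ`
(the tree's `laplacian_eq_fin_two` assumes `C^∞`; private copy of the same statement in a
Summits Theorems file, `MarginalStabilityChainStretchedVortexRows.laplacian_eq_fin_two_of_contDiff_two`,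
which a Literature file cannot import). [folklore] -/
private theorem laplacian_eq_fin_two_of_contDiff_two {φ : EuclideanSpace ℝ (Fin 2) → ℝ}
    (hφ : ContDiff ℝ 2 φ) (x : EuclideanSpace ℝ (Fin 2)) :
    Δ φ x = fderiv ℝ (fun y => fderiv ℝ φ y (EuclideanSpace.single 0 (1 : ℝ))) x
        (EuclideanSpace.single 0 (1 : ℝ)) +
      fderiv ℝ (fun y => fderiv ℝ φ y (EuclideanSpace.single 1 (1 : ℝ))) x
        (EuclideanSpace.single 1 (1 : ℝ)) := by
  have hd : DifferentiableAt ℝ (fderiv ℝ φ) x :=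
    ((hφ.fderiv_right (m := 1) (by norm_num)).differentiable one_ne_zero).differentiableAt
  have hkey : ∀ v : EuclideanSpace ℝ (Fin 2),
      fderiv ℝ (fun y => fderiv ℝ φ y v) x v = fderiv ℝ (fderiv ℝ φ) x v v := by
    intro v
    rw [fderiv_clm_apply hd (differentiableAt_const v)]
    simp
  rw [InnerProductSpace.laplacian_eq_iteratedFDeriv_orthonormalBasis φ
    (EuclideanSpace.basisFun (Fin 2) ℝ)]
  simp only [Fin.sum_univ_two, iteratedFDeriv_two_apply, EuclideanSpace.basisFun_apply,
    Matrix.cons_val_zero, Matrix.cons_val_one, hkey]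

/-- Components of a differentiable planar field differentiate componentwise:
`D(vⱼ)(x)[h] = (Dv(x)[h])ⱼ`. [folklore] -/
theorem fderiv_apply_component {v : EuclideanSpace ℝ (Fin 2) → EuclideanSpace ℝ (Fin 2)}
    {x : EuclideanSpace ℝ (Fin 2)} (hv : DifferentiableAt ℝ v x) (j : Fin 2)
    (h : EuclideanSpace ℝ (Fin 2)) :
    fderiv ℝ (fun y => v y j) x h = fderiv ℝ v x h j := by
  have hc := ((EuclideanSpace.proj (𝕜 := ℝ) j).hasFDerivAt.comp x hv.hasFDerivAt).fderiv
  rw [show (fun y => v y j) = (EuclideanSpace.proj (𝕜 := ℝ) j) ∘ v from rfl, hc]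
  rfl

/-- **`Δψ = w` pointwise for `ψ = N ∗ w`, `w ∈ C²_c(ℝ²)`**: the logarithmic potential solves the
Poisson equation (`∂₀ψ = v₁`, `∂₁ψ = −v₀`, so `Δψ = ∂₀v₁ − ∂₁v₀ = curl v = w`,
`curl_biotSavart2D_eq`). [cite: GilbargTrudinger2001, Lemma 4.2] -/
theorem laplacian_logPotential {w : EuclideanSpace ℝ (Fin 2) → ℝ} (hw : ContDiff ℝ 2 w)
    (hwc : HasCompactSupport w) (x : EuclideanSpace ℝ (Fin 2)) :
    Δ (fun x => ∫ y, w y * ((2 * π)⁻¹ * Real.log ‖x - y‖)) x = w x := by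
  have hw1 : ContDiff ℝ 1 w := hw.of_le (by norm_num)
  have hψ2 : ContDiff ℝ 2 fun x => ∫ y, w y * ((2 * π)⁻¹ * Real.log ‖x - y‖) :=
    contDiff_logPotential hw hwc
  rw [laplacian_eq_fin_two_of_contDiff_two hψ2]
  have h0 : (fun y => fderiv ℝ (fun x => ∫ y, w y * ((2 * π)⁻¹ * Real.log ‖x - y‖)) y
      (EuclideanSpace.single 0 1)) = fun y => biotSavart2D w y 1 :=
    funext fun y => (fderiv_logPotential_single hw1 hwc y).1
  have h1 : (fun y => fderiv ℝ (fun x => ∫ y, w y * ((2 * π)⁻¹ * Real.log ‖x - y‖)) y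
      (EuclideanSpace.single 1 1)) = fun y => -biotSavart2D w y 0 :=
    funext fun y => (fderiv_logPotential_single hw1 hwc y).2
  rw [h0, h1, fderiv_fun_neg]
  have hvd : Differentiable ℝ (biotSavart2D w) :=
    (contDiff_biotSavart2D hw1 hwc).differentiable one_ne_zero
  rw [_root_.neg_apply, fderiv_apply_component (hvd x),
    fderiv_apply_component (hvd x), ← sub_eq_add_neg]
  exact curl_biotSavart2D_eq hw1 hwc x

end Literature.Analysis.FluidPDE
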